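import Mathlib
import HarnessLib
import Summits.HubbardSuperconductivity.HubbardSuperconductivity.Theorems.KLProgrammeC4aPartnerBandTangencyLower
import Summits.HubbardSuperconductivity.HubbardSuperconductivity.Theorems.KLProgrammeC4aFoldWindow

/-!
# Route `KLProgramme` — crux C4a, S3 (B4)-(T) — FOLD-WINDOW CALCULUS, the INSTANCE («(B4)-TAN-FOLD», part 4): the loop-angle CROSSING REGION of the
# partner band near the tangency configurations is a small angle — `{|φ| ≤ φ₀, |ē| ≤ ε} ⊆ {φ² ≤ 2(ε + η)/a}`, measure `≤ 2√(2(ε + η)/a)`,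
# `a = (3/200)·u_min²`, `η = K₁|e|/d + K₁(|ρ|/d + D₁|ϑ − ϑ_T|)` — and the window law for `∫ w φ • Ψ(ē φ) dφ`

Cell `gate-hubbard-kl`, seat hubbard-kl-k3c3-p3 (g21; row «implicit-function / monotonicity route»); helper for stub (C) `stub_twoLeg_curvature` of the
engine-flow child `KLRegimeEngineV17F2` (stmt-HubbardSuperconductivity-20437); memo HOME/hubbard-kl-c4a-1/C4A-PLAN.md §24.4 (power counting near (T):
«`𝒜 ≲ e + φ² ≲ 2^{−J}` on the crossing region of measure … `2^{−J/2}`») and §24.9 («the crossing-region input of §24.4: `{|ē| ≲ 2^{−J}} ⊂ {φ² ≲ 2^{−J} + |e| + δ}`,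
measure `≲ 2^{−J/2}` when `|e|, δ ≲ 2^{−J}`»).  This file is that sentence BY NAME: the landed two-sided value
`…C4aPartnerBandTangencyLower.partnerBand_pp/ph_tangency_lower` (`a·φ² − C₃|φ|³ − η ≤ |ē|`) fed to the carrier-free sublevel geometry of `…C4aFoldWindow`.
The loop-angle window is `|φ| ≤ φ₀` with `C₃·φ₀ ≤ a/2` (`C₃ = K₃D₁³ + 3K₂D₁D₂ + K₁D₃`, `D_j = msD A₃ A₄ j`; `tangencyCubicConst_nonneg`).

* **`sq_le_of_partnerBand_pp_tangency`** / **`_ph_`** — `|φ| ≤ φ₀`, `|ē(e,φ;ρ,ϑ,θ)| ≤ ε` ⟹ `φ² ≤ 2(ε + η)/a` (pp: `ē = e_K(S_{ρϑθ}(0) − Φ(e,φ+θ))`, `η` with `|ϑ|`;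
  ph: `ē = e_K(Φ(e,φ+θ) − D_{ρϑθ}(0))`, `η` with `|ϑ − π|`) — on the support of a shell function of the partner level the anisotropy factors
  `|𝒜| ≲ |e| + φ² + |ρ| + |ϑ − ϑ_T|` are `≲ ε + η`;
* **`volume_crossing_pp_tangency_le`** / **`_ph_`** — `vol {φ : |φ| ≤ φ₀ ∧ |ē| ≤ ε} ≤ 2·√(2(ε + η)/a)`;
* **`norm_setIntegral_smul_partnerBand_pp_tangency_le`** / **`_ph_`** — `‖∫_s w φ • Ψ(ē φ) dφ‖ ≤ W·M·2√(2(ε + η)/a)` for `Ψ` supported in `|y| ≤ ε` with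
  `‖Ψ‖ ≤ M` and a weight vanishing off the window with `|w| ≤ W` on the crossing region (any set `s`, e.g. the loop circle `Ioo (−π) π`).

Hypotheses = those of `…C4aPartnerBandTangencyLower` (frame sizes `A ≤ 1/20`, `A₃`, `A₄`, global `‖Dʲe_K‖ ≤ K_j`, tube margins, `FrameOK R U N μ K` for the
curvature floor).  Bookkeeping on landed objects; nothing about the model's sizes; nothing asserts superconductivity.
References: FST II CPAM 51 (1998) Lemma 2.1, §3 [cite: FeldmanSalmhoferTrubowitz1998]; BGM 2006 §2.4 [cite: BenfattoGiulianiMastropietro2006].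
-/

noncomputable section

namespace Summit.HubbardSuperconductivity.HubbardSuperconductivity.Theorems.C4a

set_option linter.dupNamespace false -- summit = problem name (single-conjunct summit), D-0017

open Real Set Filter MeasureTheory
open scoped Topology ENNReal
open Literature.MathematicalPhysics.QuantumLattice Literature.MathematicalPhysics.QuantumLattice.BandSectorCounting Literature.Probability.LatticeModels
open Summit.HubbardSuperconductivity.HubbardSuperconductivity.Theorems.KLRegimeSplit
open Summit.HubbardSuperconductivity.HubbardSuperconductivity.Theorems.DispersionFlow
open Summit.HubbardSuperconductivity.HubbardSuperconductivity.Theorems.PerturbedFermiCurve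

variable {E : Type*} [NormedAddCommGroup E] [NormedSpace ℝ E]

/-! ## §1 The cubic constant is nonnegative -/

section Const

variable {K : TrigPolyC4v} {μ : ℝ} {A₃ A₄ K₁ K₂ K₃ : ℝ}

/-- `0 ≤ C₃ = K₃D₁³ + 3K₂D₁D₂ + K₁D₃` (the `K_j` dominate norms; `D₁, D₂ ≥ 0` always, `D₃ ≥ 0` since `A₃ ≥ 0`). -/
theorem tangencyCubicConst_nonneg (hA₃ : ∀ p : Momentum, ‖iteratedFDeriv ℝ 3 (frameShift K) p‖ ≤ A₃)
    (hK₁ : ∀ p : Momentum, ‖fderiv ℝ (frameLevel μ K) p‖ ≤ K₁) (hK₂ : ∀ p : Momentum, ‖iteratedFDeriv ℝ 2 (frameLevel μ K) p‖ ≤ K₂)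
    (hK₃ : ∀ p : Momentum, ‖iteratedFDeriv ℝ 3 (frameLevel μ K) p‖ ≤ K₃) :
    0 ≤ K₃ * msD A₃ A₄ 1 ^ 3 + 3 * K₂ * msD A₃ A₄ 1 * msD A₃ A₄ 2 + K₁ * msD A₃ A₄ 3 := by
  have hK₁0 : 0 ≤ K₁ := (norm_nonneg _).trans (hK₁ 0)
  have hK₂0 : 0 ≤ K₂ := (norm_nonneg _).trans (hK₂ 0)
  have hK₃0 : 0 ≤ K₃ := (norm_nonneg _).trans (hK₃ 0)
  have hA₃0 : 0 ≤ A₃ := (norm_nonneg _).trans (hA₃ 0)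
  have hD1 : 0 ≤ msD A₃ A₄ 1 := by
    show 0 ≤ klCurveD1; unfold klCurveD1; have := klCurveR1_nonneg; positivity
  have hD2 : 0 ≤ msD A₃ A₄ 2 := by
    show 0 ≤ klCurveD2; unfold klCurveD2; have := klCurveR1_nonneg; have := klCurveR2_nonneg; positivity
  have hD3 : 0 ≤ msD A₃ A₄ 3 := by
    show 0 ≤ klCurveD3 A₃; unfold klCurveD3
    have := klCurveR1_nonneg; have := klCurveR2_nonneg; have := klCurveT3_nonneg hA₃0; positivity
  positivity

end Const

/-! ## §2 The crossing region near the tangency configurations -/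

section Sizes

variable {K : TrigPolyC4v} {A : ℝ} (hA : ∀ p : Momentum, ∀ j ≤ 2, ‖iteratedFDeriv ℝ j (frameShift K) p‖ ≤ A) (hA20 : A ≤ 1 / 20)
  (hd : klCurveD ≤ (bandBounds (show (-4 : ℝ) < -1.1 by norm_num) (show (-1.1 : ℝ) ≤ -0.1 by norm_num)
    (show (-0.1 : ℝ) < 0 by norm_num)).Dtmin - 2 * A)
  {μ r : ℝ} (hr : 0 < r) (hlo : (-1.1 : ℝ) < μ - r - A) (hhi : μ + r + A < -0.1)
  {A₃ A₄ : ℝ} (hA₃ : ∀ p : Momentum, ‖iteratedFDeriv ℝ 3 (frameShift K) p‖ ≤ A₃)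
  (hA₄ : ∀ p : Momentum, ‖iteratedFDeriv ℝ 4 (frameShift K) p‖ ≤ A₄)
  {K₁ K₂ K₃ : ℝ} (hK₁ : ∀ p : Momentum, ‖fderiv ℝ (frameLevel μ K) p‖ ≤ K₁) (hK₂ : ∀ p : Momentum, ‖iteratedFDeriv ℝ 2 (frameLevel μ K) p‖ ≤ K₂)
  (hK₃ : ∀ p : Momentum, ‖iteratedFDeriv ℝ 3 (frameLevel μ K) p‖ ≤ K₃)
include hA hA20 hd hr hlo hhi hA₃ hA₄ hK₁ hK₂ hK₃

/-- **pp FOLD LOWER BOUND IN WINDOW SHAPE**: the landed two-sided value, regrouped as `a·φ² − C₃·|φ|³ − η ≤ |ē|` for every loop angle. -/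
theorem partnerBand_pp_fold_lower {R : RenConsts} {U : ℝ} {N : ℕ} (hF : FrameOK R U N μ K) {ρ : ℝ} (hρ : |ρ| < r) {e : ℝ} (he : |e| < r)
    (ϑ θ φ₀ : ℝ) : ∀ φ : ℝ, |φ| ≤ φ₀ →
      3 / 200 * (bandBounds (show (-4 : ℝ) < -1.1 by norm_num) (show (-1.1 : ℝ) ≤ -0.1 by norm_num) (show (-0.1 : ℝ) < 0 by norm_num)).umin ^ 2 * φ ^ 2 -
          (K₃ * msD A₃ A₄ 1 ^ 3 + 3 * K₂ * msD A₃ A₄ 1 * msD A₃ A₄ 2 + K₁ * msD A₃ A₄ 3) * |φ| ^ 3 -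
          (K₁ * (|e| / ((bandBounds (show (-4 : ℝ) < -1.1 by norm_num) (show (-1.1 : ℝ) ≤ -0.1 by norm_num) (show (-0.1 : ℝ) < 0 by norm_num)).Dtmin - 2 * A)) +
            K₁ * (|ρ| / ((bandBounds (show (-4 : ℝ) < -1.1 by norm_num) (show (-1.1 : ℝ) ≤ -0.1 by norm_num) (show (-0.1 : ℝ) < 0 by norm_num)).Dtmin - 2 * A) +
              msD A₃ A₄ 1 * |ϑ|)) ≤
        |frameLevel μ K (pairSumPath μ K ρ ϑ θ 0 - levelPoint μ K e (φ + θ))| := by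
  intro φ _
  have h := partnerBand_pp_tangency_lower hA hA20 hd hr hlo hhi hA₃ hA₄ hK₁ hK₂ hK₃ hF hρ he ϑ θ φ
  linarith

/-- **ph FOLD LOWER BOUND IN WINDOW SHAPE** (tangency of the pair-difference path at `ϑ = π`). -/
theorem partnerBand_ph_fold_lower {R : RenConsts} {U : ℝ} {N : ℕ} (hF : FrameOK R U N μ K) {ρ : ℝ} (hρ : |ρ| < r) {e : ℝ} (he : |e| < r)
    (ϑ θ φ₀ : ℝ) : ∀ φ : ℝ, |φ| ≤ φ₀ →
      3 / 200 * (bandBounds (show (-4 : ℝ) < -1.1 by norm_num) (show (-1.1 : ℝ) ≤ -0.1 by norm_num) (show (-0.1 : ℝ) < 0 by norm_num)).umin ^ 2 * φ ^ 2 -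
          (K₃ * msD A₃ A₄ 1 ^ 3 + 3 * K₂ * msD A₃ A₄ 1 * msD A₃ A₄ 2 + K₁ * msD A₃ A₄ 3) * |φ| ^ 3 -
          (K₁ * (|e| / ((bandBounds (show (-4 : ℝ) < -1.1 by norm_num) (show (-1.1 : ℝ) ≤ -0.1 by norm_num) (show (-0.1 : ℝ) < 0 by norm_num)).Dtmin - 2 * A)) +
            K₁ * (|ρ| / ((bandBounds (show (-4 : ℝ) < -1.1 by norm_num) (show (-1.1 : ℝ) ≤ -0.1 by norm_num) (show (-0.1 : ℝ) < 0 by norm_num)).Dtmin - 2 * A) +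
              msD A₃ A₄ 1 * |ϑ - π|)) ≤
        |frameLevel μ K (levelPoint μ K e (φ + θ) - pairDiffPath μ K ρ ϑ θ 0)| := by
  intro φ _
  have h := partnerBand_ph_tangency_lower hA hA20 hd hr hlo hhi hA₃ hA₄ hK₁ hK₂ hK₃ hF hρ he ϑ θ φ
  linarith

/-- **THE pp CROSSING REGION IS A SMALL ANGLE**: on the window `|φ| ≤ φ₀` with `C₃·φ₀ ≤ a/2`, `|ē| ≤ ε` ⟹ `φ² ≤ 2(ε + η)/a`. -/
theorem sq_le_of_partnerBand_pp_tangency {R : RenConsts} {U : ℝ} {N : ℕ} (hF : FrameOK R U N μ K) {ρ : ℝ} (hρ : |ρ| < r) {e : ℝ} (he : |e| < r)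
    (ϑ θ : ℝ) {φ₀ : ℝ} (hwin : (K₃ * msD A₃ A₄ 1 ^ 3 + 3 * K₂ * msD A₃ A₄ 1 * msD A₃ A₄ 2 + K₁ * msD A₃ A₄ 3) * φ₀ ≤
      3 / 200 * (bandBounds (show (-4 : ℝ) < -1.1 by norm_num) (show (-1.1 : ℝ) ≤ -0.1 by norm_num) (show (-0.1 : ℝ) < 0 by norm_num)).umin ^ 2 / 2)
    {φ : ℝ} (hφ : |φ| ≤ φ₀) {ε : ℝ} (hε : |frameLevel μ K (pairSumPath μ K ρ ϑ θ 0 - levelPoint μ K e (φ + θ))| ≤ ε) :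
    φ ^ 2 ≤ 2 * (ε + (K₁ * (|e| / ((bandBounds (show (-4 : ℝ) < -1.1 by norm_num) (show (-1.1 : ℝ) ≤ -0.1 by norm_num) (show (-0.1 : ℝ) < 0 by norm_num)).Dtmin - 2 * A)) +
            K₁ * (|ρ| / ((bandBounds (show (-4 : ℝ) < -1.1 by norm_num) (show (-1.1 : ℝ) ≤ -0.1 by norm_num) (show (-0.1 : ℝ) < 0 by norm_num)).Dtmin - 2 * A) +
              msD A₃ A₄ 1 * |ϑ|))) /
      (3 / 200 * (bandBounds (show (-4 : ℝ) < -1.1 by norm_num) (show (-1.1 : ℝ) ≤ -0.1 by norm_num) (show (-0.1 : ℝ) < 0 by norm_num)).umin ^ 2) := by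
  have hu := (bandBounds (show (-4 : ℝ) < -1.1 by norm_num) (show (-1.1 : ℝ) ≤ -0.1 by norm_num) (show (-0.1 : ℝ) < 0 by norm_num)).umin_pos
  exact sq_le_of_fold_lower (by positivity) (tangencyCubicConst_nonneg hA₃ hK₁ hK₂ hK₃) hwin
    (partnerBand_pp_fold_lower hA hA20 hd hr hlo hhi hA₃ hA₄ hK₁ hK₂ hK₃ hF hρ he ϑ θ φ₀) hφ hε

/-- **THE ph CROSSING REGION IS A SMALL ANGLE**. -/
theorem sq_le_of_partnerBand_ph_tangency {R : RenConsts} {U : ℝ} {N : ℕ} (hF : FrameOK R U N μ K) {ρ : ℝ} (hρ : |ρ| < r) {e : ℝ} (he : |e| < r)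
    (ϑ θ : ℝ) {φ₀ : ℝ} (hwin : (K₃ * msD A₃ A₄ 1 ^ 3 + 3 * K₂ * msD A₃ A₄ 1 * msD A₃ A₄ 2 + K₁ * msD A₃ A₄ 3) * φ₀ ≤
      3 / 200 * (bandBounds (show (-4 : ℝ) < -1.1 by norm_num) (show (-1.1 : ℝ) ≤ -0.1 by norm_num) (show (-0.1 : ℝ) < 0 by norm_num)).umin ^ 2 / 2)
    {φ : ℝ} (hφ : |φ| ≤ φ₀) {ε : ℝ} (hε : |frameLevel μ K (levelPoint μ K e (φ + θ) - pairDiffPath μ K ρ ϑ θ 0)| ≤ ε) :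
    φ ^ 2 ≤ 2 * (ε + (K₁ * (|e| / ((bandBounds (show (-4 : ℝ) < -1.1 by norm_num) (show (-1.1 : ℝ) ≤ -0.1 by norm_num) (show (-0.1 : ℝ) < 0 by norm_num)).Dtmin - 2 * A)) +
            K₁ * (|ρ| / ((bandBounds (show (-4 : ℝ) < -1.1 by norm_num) (show (-1.1 : ℝ) ≤ -0.1 by norm_num) (show (-0.1 : ℝ) < 0 by norm_num)).Dtmin - 2 * A) +
              msD A₃ A₄ 1 * |ϑ - π|))) /
      (3 / 200 * (bandBounds (show (-4 : ℝ) < -1.1 by norm_num) (show (-1.1 : ℝ) ≤ -0.1 by norm_num) (show (-0.1 : ℝ) < 0 by norm_num)).umin ^ 2) := by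
  have hu := (bandBounds (show (-4 : ℝ) < -1.1 by norm_num) (show (-1.1 : ℝ) ≤ -0.1 by norm_num) (show (-0.1 : ℝ) < 0 by norm_num)).umin_pos
  exact sq_le_of_fold_lower (by positivity) (tangencyCubicConst_nonneg hA₃ hK₁ hK₂ hK₃) hwin
    (partnerBand_ph_fold_lower hA hA20 hd hr hlo hhi hA₃ hA₄ hK₁ hK₂ hK₃ hF hρ he ϑ θ φ₀) hφ hε

/-- **MEASURE OF THE pp CROSSING REGION**: `vol {φ : |φ| ≤ φ₀ ∧ |ē| ≤ ε} ≤ 2·√(2(ε + η)/a)` — the `2^{−J/2}` of C4A-PLAN §24.4 at `ε ≍ 2^{−J}`, `|e|, δ ≲ 2^{−J}`. -/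
theorem volume_crossing_pp_tangency_le {R : RenConsts} {U : ℝ} {N : ℕ} (hF : FrameOK R U N μ K) {ρ : ℝ} (hρ : |ρ| < r) {e : ℝ} (he : |e| < r)
    (ϑ θ : ℝ) {φ₀ : ℝ} (hwin : (K₃ * msD A₃ A₄ 1 ^ 3 + 3 * K₂ * msD A₃ A₄ 1 * msD A₃ A₄ 2 + K₁ * msD A₃ A₄ 3) * φ₀ ≤
      3 / 200 * (bandBounds (show (-4 : ℝ) < -1.1 by norm_num) (show (-1.1 : ℝ) ≤ -0.1 by norm_num) (show (-0.1 : ℝ) < 0 by norm_num)).umin ^ 2 / 2) (ε : ℝ) :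
    volume {φ : ℝ | |φ| ≤ φ₀ ∧ |frameLevel μ K (pairSumPath μ K ρ ϑ θ 0 - levelPoint μ K e (φ + θ))| ≤ ε} ≤
      ENNReal.ofReal (2 * Real.sqrt (2 * (ε + (K₁ * (|e| / ((bandBounds (show (-4 : ℝ) < -1.1 by norm_num) (show (-1.1 : ℝ) ≤ -0.1 by norm_num) (show (-0.1 : ℝ) < 0 by norm_num)).Dtmin - 2 * A)) +
            K₁ * (|ρ| / ((bandBounds (show (-4 : ℝ) < -1.1 by norm_num) (show (-1.1 : ℝ) ≤ -0.1 by norm_num) (show (-0.1 : ℝ) < 0 by norm_num)).Dtmin - 2 * A) +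
              msD A₃ A₄ 1 * |ϑ|))) /
        (3 / 200 * (bandBounds (show (-4 : ℝ) < -1.1 by norm_num) (show (-1.1 : ℝ) ≤ -0.1 by norm_num) (show (-0.1 : ℝ) < 0 by norm_num)).umin ^ 2))) := by
  have hu := (bandBounds (show (-4 : ℝ) < -1.1 by norm_num) (show (-1.1 : ℝ) ≤ -0.1 by norm_num) (show (-0.1 : ℝ) < 0 by norm_num)).umin_pos
  exact volume_fold_sublevel_le (by positivity) (tangencyCubicConst_nonneg hA₃ hK₁ hK₂ hK₃) hwin
    (partnerBand_pp_fold_lower hA hA20 hd hr hlo hhi hA₃ hA₄ hK₁ hK₂ hK₃ hF hρ he ϑ θ φ₀) ε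

/-- **MEASURE OF THE ph CROSSING REGION**. -/
theorem volume_crossing_ph_tangency_le {R : RenConsts} {U : ℝ} {N : ℕ} (hF : FrameOK R U N μ K) {ρ : ℝ} (hρ : |ρ| < r) {e : ℝ} (he : |e| < r)
    (ϑ θ : ℝ) {φ₀ : ℝ} (hwin : (K₃ * msD A₃ A₄ 1 ^ 3 + 3 * K₂ * msD A₃ A₄ 1 * msD A₃ A₄ 2 + K₁ * msD A₃ A₄ 3) * φ₀ ≤
      3 / 200 * (bandBounds (show (-4 : ℝ) < -1.1 by norm_num) (show (-1.1 : ℝ) ≤ -0.1 by norm_num) (show (-0.1 : ℝ) < 0 by norm_num)).umin ^ 2 / 2) (ε : ℝ) :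
    volume {φ : ℝ | |φ| ≤ φ₀ ∧ |frameLevel μ K (levelPoint μ K e (φ + θ) - pairDiffPath μ K ρ ϑ θ 0)| ≤ ε} ≤
      ENNReal.ofReal (2 * Real.sqrt (2 * (ε + (K₁ * (|e| / ((bandBounds (show (-4 : ℝ) < -1.1 by norm_num) (show (-1.1 : ℝ) ≤ -0.1 by norm_num) (show (-0.1 : ℝ) < 0 by norm_num)).Dtmin - 2 * A)) +
            K₁ * (|ρ| / ((bandBounds (show (-4 : ℝ) < -1.1 by norm_num) (show (-1.1 : ℝ) ≤ -0.1 by norm_num) (show (-0.1 : ℝ) < 0 by norm_num)).Dtmin - 2 * A) +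
              msD A₃ A₄ 1 * |ϑ - π|))) /
        (3 / 200 * (bandBounds (show (-4 : ℝ) < -1.1 by norm_num) (show (-1.1 : ℝ) ≤ -0.1 by norm_num) (show (-0.1 : ℝ) < 0 by norm_num)).umin ^ 2))) := by
  have hu := (bandBounds (show (-4 : ℝ) < -1.1 by norm_num) (show (-1.1 : ℝ) ≤ -0.1 by norm_num) (show (-0.1 : ℝ) < 0 by norm_num)).umin_pos
  exact volume_fold_sublevel_le (by positivity) (tangencyCubicConst_nonneg hA₃ hK₁ hK₂ hK₃) hwin
    (partnerBand_ph_fold_lower hA hA20 hd hr hlo hhi hA₃ hA₄ hK₁ hK₂ hK₃ hF hρ he ϑ θ φ₀) ε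

/-- **THE pp TANGENCY-WINDOW LAW**: `Ψ : ℝ → E` supported in `|y| ≤ ε` with `‖Ψ‖ ≤ M`, a weight `w` vanishing off `|φ| ≤ φ₀` with `|w| ≤ W` on the crossing
region ⟹ `‖∫_s w φ • Ψ(ē(e,φ;ρ,ϑ,θ)) dφ‖ ≤ W·M·2√(2(ε + η)/a)` for every set `s` of loop angles. -/
theorem norm_setIntegral_smul_partnerBand_pp_tangency_le {R : RenConsts} {U : ℝ} {N : ℕ} (hF : FrameOK R U N μ K) {ρ : ℝ} (hρ : |ρ| < r)
    {e : ℝ} (he : |e| < r) (ϑ θ : ℝ) {φ₀ : ℝ} (hwin : (K₃ * msD A₃ A₄ 1 ^ 3 + 3 * K₂ * msD A₃ A₄ 1 * msD A₃ A₄ 2 + K₁ * msD A₃ A₄ 3) * φ₀ ≤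
      3 / 200 * (bandBounds (show (-4 : ℝ) < -1.1 by norm_num) (show (-1.1 : ℝ) ≤ -0.1 by norm_num) (show (-0.1 : ℝ) < 0 by norm_num)).umin ^ 2 / 2)
    {ε M W : ℝ} {Ψ : ℝ → E} (hΨ0 : ∀ y, ε < |y| → Ψ y = 0) (hΨM : ∀ y, ‖Ψ y‖ ≤ M) (hM : 0 ≤ M) {w : ℝ → ℝ} (hw0 : ∀ φ, φ₀ < |φ| → w φ = 0)
    (hwW : ∀ φ, |φ| ≤ φ₀ → φ ^ 2 ≤ 2 * (ε + (K₁ * (|e| / ((bandBounds (show (-4 : ℝ) < -1.1 by norm_num) (show (-1.1 : ℝ) ≤ -0.1 by norm_num) (show (-0.1 : ℝ) < 0 by norm_num)).Dtmin - 2 * A)) +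
            K₁ * (|ρ| / ((bandBounds (show (-4 : ℝ) < -1.1 by norm_num) (show (-1.1 : ℝ) ≤ -0.1 by norm_num) (show (-0.1 : ℝ) < 0 by norm_num)).Dtmin - 2 * A) +
              msD A₃ A₄ 1 * |ϑ|))) /
      (3 / 200 * (bandBounds (show (-4 : ℝ) < -1.1 by norm_num) (show (-1.1 : ℝ) ≤ -0.1 by norm_num) (show (-0.1 : ℝ) < 0 by norm_num)).umin ^ 2) → |w φ| ≤ W)
    (hW : 0 ≤ W) (s : Set ℝ) :
    ‖∫ φ in s, w φ • Ψ (frameLevel μ K (pairSumPath μ K ρ ϑ θ 0 - levelPoint μ K e (φ + θ)))‖ ≤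
      W * M * (2 * Real.sqrt (2 * (ε + (K₁ * (|e| / ((bandBounds (show (-4 : ℝ) < -1.1 by norm_num) (show (-1.1 : ℝ) ≤ -0.1 by norm_num) (show (-0.1 : ℝ) < 0 by norm_num)).Dtmin - 2 * A)) +
            K₁ * (|ρ| / ((bandBounds (show (-4 : ℝ) < -1.1 by norm_num) (show (-1.1 : ℝ) ≤ -0.1 by norm_num) (show (-0.1 : ℝ) < 0 by norm_num)).Dtmin - 2 * A) +
              msD A₃ A₄ 1 * |ϑ|))) /
        (3 / 200 * (bandBounds (show (-4 : ℝ) < -1.1 by norm_num) (show (-1.1 : ℝ) ≤ -0.1 by norm_num) (show (-0.1 : ℝ) < 0 by norm_num)).umin ^ 2))) := by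
  have hu := (bandBounds (show (-4 : ℝ) < -1.1 by norm_num) (show (-1.1 : ℝ) ≤ -0.1 by norm_num) (show (-0.1 : ℝ) < 0 by norm_num)).umin_pos
  exact norm_setIntegral_smul_comp_le_fold (g := fun φ => frameLevel μ K (pairSumPath μ K ρ ϑ θ 0 - levelPoint μ K e (φ + θ))) (by positivity)
    (tangencyCubicConst_nonneg hA₃ hK₁ hK₂ hK₃) hwin (partnerBand_pp_fold_lower hA hA20 hd hr hlo hhi hA₃ hA₄ hK₁ hK₂ hK₃ hF hρ he ϑ θ φ₀)
    hΨ0 hΨM hM hw0 hwW hW s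

/-- **THE ph TANGENCY-WINDOW LAW**. -/
theorem norm_setIntegral_smul_partnerBand_ph_tangency_le {R : RenConsts} {U : ℝ} {N : ℕ} (hF : FrameOK R U N μ K) {ρ : ℝ} (hρ : |ρ| < r)
    {e : ℝ} (he : |e| < r) (ϑ θ : ℝ) {φ₀ : ℝ} (hwin : (K₃ * msD A₃ A₄ 1 ^ 3 + 3 * K₂ * msD A₃ A₄ 1 * msD A₃ A₄ 2 + K₁ * msD A₃ A₄ 3) * φ₀ ≤
      3 / 200 * (bandBounds (show (-4 : ℝ) < -1.1 by norm_num) (show (-1.1 : ℝ) ≤ -0.1 by norm_num) (show (-0.1 : ℝ) < 0 by norm_num)).umin ^ 2 / 2)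
    {ε M W : ℝ} {Ψ : ℝ → E} (hΨ0 : ∀ y, ε < |y| → Ψ y = 0) (hΨM : ∀ y, ‖Ψ y‖ ≤ M) (hM : 0 ≤ M) {w : ℝ → ℝ} (hw0 : ∀ φ, φ₀ < |φ| → w φ = 0)
    (hwW : ∀ φ, |φ| ≤ φ₀ → φ ^ 2 ≤ 2 * (ε + (K₁ * (|e| / ((bandBounds (show (-4 : ℝ) < -1.1 by norm_num) (show (-1.1 : ℝ) ≤ -0.1 by norm_num) (show (-0.1 : ℝ) < 0 by norm_num)).Dtmin - 2 * A)) +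
            K₁ * (|ρ| / ((bandBounds (show (-4 : ℝ) < -1.1 by norm_num) (show (-1.1 : ℝ) ≤ -0.1 by norm_num) (show (-0.1 : ℝ) < 0 by norm_num)).Dtmin - 2 * A) +
              msD A₃ A₄ 1 * |ϑ - π|))) /
      (3 / 200 * (bandBounds (show (-4 : ℝ) < -1.1 by norm_num) (show (-1.1 : ℝ) ≤ -0.1 by norm_num) (show (-0.1 : ℝ) < 0 by norm_num)).umin ^ 2) → |w φ| ≤ W)
    (hW : 0 ≤ W) (s : Set ℝ) :
    ‖∫ φ in s, w φ • Ψ (frameLevel μ K (levelPoint μ K e (φ + θ) - pairDiffPath μ K ρ ϑ θ 0))‖ ≤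
      W * M * (2 * Real.sqrt (2 * (ε + (K₁ * (|e| / ((bandBounds (show (-4 : ℝ) < -1.1 by norm_num) (show (-1.1 : ℝ) ≤ -0.1 by norm_num) (show (-0.1 : ℝ) < 0 by norm_num)).Dtmin - 2 * A)) +
            K₁ * (|ρ| / ((bandBounds (show (-4 : ℝ) < -1.1 by norm_num) (show (-1.1 : ℝ) ≤ -0.1 by norm_num) (show (-0.1 : ℝ) < 0 by norm_num)).Dtmin - 2 * A) +
              msD A₃ A₄ 1 * |ϑ - π|))) /
        (3 / 200 * (bandBounds (show (-4 : ℝ) < -1.1 by norm_num) (show (-1.1 : ℝ) ≤ -0.1 by norm_num) (show (-0.1 : ℝ) < 0 by norm_num)).umin ^ 2))) := by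
  have hu := (bandBounds (show (-4 : ℝ) < -1.1 by norm_num) (show (-1.1 : ℝ) ≤ -0.1 by norm_num) (show (-0.1 : ℝ) < 0 by norm_num)).umin_pos
  exact norm_setIntegral_smul_comp_le_fold (g := fun φ => frameLevel μ K (levelPoint μ K e (φ + θ) - pairDiffPath μ K ρ ϑ θ 0)) (by positivity)
    (tangencyCubicConst_nonneg hA₃ hK₁ hK₂ hK₃) hwin (partnerBand_ph_fold_lower hA hA20 hd hr hlo hhi hA₃ hA₄ hK₁ hK₂ hK₃ hF hρ he ϑ θ φ₀)
    hΨ0 hΨM hM hw0 hwW hW s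

end Sizes

end Summit.HubbardSuperconductivity.HubbardSuperconductivity.Theorems.C4a

end
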